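import Summits.Langlands.Langlands.Theses.ParityBlindBianchi
import Summits.Langlands.Langlands.Theorems.ResidualBianchiDoorLevel.Negative.FalseWithoutIcosahedral

/-!
# `ResidualBianchiDoorLevelBC` (E1″, stmt-Langlands-16853): without its icosahedral hypotheses the
# door is the negation of its own antecedent

Negative-side lemma (refuter cdisprove seat, 2026-08-17; supports stmt-Langlands-16853; does NOT refute
the crux — the crux is `QuadraticBaseChangeGL2 → ResidualBianchiDoorLevelR` and is proved by the picked
line modulo the cited fact `khare_wintenberger 2`).

`ParityBlindBianchi.ResidualBianchiDoorLevelBC` is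
`QuadraticBaseChangeGL2 → ∀ ι ρ, hirr → hA5 → ∃ S₀, 2 ∈ S₀ ∧ 0 ∉ S₀ ∧ ∀ K (totally complex, quadratic,
2 split), ∃ σ (pinned entrywise to ρ|_K through ι) with finite image, irreducible, projective image
≅ A₅, ∃ π₀ regular algebraic cuspidal, congruence at every good place`.

* `residualBianchiDoorLevelBC_withoutIcosahedral_iff_not_quadraticBaseChangeGL2` — with the two
  hypotheses on `ρ` (`hirr`, `hA5`) DELETED (statement inline), E1″ is EQUIVALENT to
  `¬ QuadraticBaseChangeGL2`: given the antecedent, the body is refuted by the landed witness of the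
  sibling E1′ (`ResidualBianchiDoorLevel.Negative.residualBianchiDoorLevel_false_without_icosahedral`:
  the trivial `ρ`, `K = ℚ(√-15)`, pinned model trivial, projective image `1 ≇ A₅`); conversely ex falso.
* `residualBianchiDoorLevelBC_false_without_icosahedral_of_quadraticBaseChangeGL2` — the
  `_false_without_` shape: quadratic base change (a theorem in print, Langlands 1980 / Arthur–Clozel
  III.4.2 (a), 5.1; the promoted crux stmt-Langlands-16812) refutes the icosahedral-free door.  So any
  proof of E1″ must use `hA5` (while `hirr` is implied by it, sibling `isIrreducible_of_icosahedral`).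
-/

noncomputable section

set_option linter.dupNamespace false

namespace Summit.Langlands.Langlands.Theorems.ResidualBianchiDoorLevelBC.Negative

open scoped MatrixGroups NumberField
open NumberField IsDedekindDomain Field
open Literature.NumberTheory.Automorphic Literature.NumberTheory.GaloisRepresentations
  Summit.Langlands.Langlands.Theses.ParityBlindBianchi

/-- **E1″ without its icosahedral hypotheses is `¬ QuadraticBaseChangeGL2`.**  The left-hand side is
`ResidualBianchiDoorLevelBC` verbatim with `ρ.toGaloisRep.IsIrreducible →` and
`Nonempty (… ≃* alternatingGroup (Fin 5)) →` deleted.  (→) feed the antecedent, drop `0 ∉ S₀`, and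
apply the landed sibling refutation (witness `ρ = 1`, `K = ℚ(√-15)`); (←) ex falso quodlibet.
[folklore] -/
theorem residualBianchiDoorLevelBC_withoutIcosahedral_iff_not_quadraticBaseChangeGL2 :
    (QuadraticBaseChangeGL2 → ∀ (ι : PadicAlgCl 2 ≃+* ℂ) (ρ : FramedGaloisRep ℚ ℂ 2),
      ∃ S₀ : Finset ℕ, 2 ∈ S₀ ∧ (0 : ℕ) ∉ S₀ ∧ ∀ (K : Type) [Field K] [NumberField K],
        IsTotallyComplex K → Module.finrank ℚ K = 2 →
        (∃ v w : HeightOneSpectrum (𝓞 K), v ≠ w ∧ ((2 : ℕ) : 𝓞 K) ∈ v.asIdeal ∧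
          ((2 : ℕ) : 𝓞 K) ∈ w.asIdeal) →
        ∃ σ : FramedGaloisRep K (PadicAlgCl 2) 2,
          (∀ (g : absoluteGaloisGroup K) (i j : Fin 2),
            ι ((σ g).val i j) = ((FramedGaloisRep.restrictField K ρ) g).val i j) ∧
          Finite σ.toMonoidHom.range ∧ σ.toGaloisRep.IsIrreducible ∧
          Nonempty ((Matrix.ProjGenLinGroup.mk.comp σ.toMonoidHom).range ≃*
            alternatingGroup (Fin 5)) ∧
          ∃ (hcpt : isCompact_glFiniteIntegralLevel 2 K)
            (π₀ : CuspidalAutomorphicRepData 2 K hcpt), π₀.1.IsRegularAlgebraic ∧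
            ∀ v : HeightOneSpectrum (𝓞 K), (∀ ℓ ∈ S₀, ((ℓ : ℕ) : 𝓞 K) ∉ v.asIdeal) →
              ∃ (α : Multiset ℂ) (P : Polynomial (PadicAlgCl 2)), π₀.1.HasSatakeParamAt v α ∧
                σ.IsUnramifiedAt v ∧ σ.HasFrobCharpolyAt v P ∧
                ∀ i : ℕ, ‖P.coeff i - (arithFrobPolyOfSatake ι v.residueCard 2 α).coeff i‖ < 1) ↔
      ¬ QuadraticBaseChangeGL2 := by
  refine ⟨fun h hQ => ?_, fun hnQ hQ => absurd hQ hnQ⟩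
  apply ResidualBianchiDoorLevel.Negative.residualBianchiDoorLevel_false_without_icosahedral
  intro ι ρ
  obtain ⟨S₀, h2, -, hK⟩ := h hQ ι ρ
  exact ⟨S₀, h2, fun K _ _ htc hdeg hsplit => hK K htc hdeg hsplit⟩

/-- **`_false_without_` shape**: granted quadratic base change for `GL₂` (the antecedent, a theorem in
print), E1″ with its icosahedral hypotheses deleted is FALSE — any proof of the crux must use `hA5`.
[folklore] -/
theorem residualBianchiDoorLevelBC_false_without_icosahedral_of_quadraticBaseChangeGL2
    (hQ : QuadraticBaseChangeGL2) :
    ¬ (QuadraticBaseChangeGL2 → ∀ (ι : PadicAlgCl 2 ≃+* ℂ) (ρ : FramedGaloisRep ℚ ℂ 2),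
      ∃ S₀ : Finset ℕ, 2 ∈ S₀ ∧ (0 : ℕ) ∉ S₀ ∧ ∀ (K : Type) [Field K] [NumberField K],
        IsTotallyComplex K → Module.finrank ℚ K = 2 →
        (∃ v w : HeightOneSpectrum (𝓞 K), v ≠ w ∧ ((2 : ℕ) : 𝓞 K) ∈ v.asIdeal ∧
          ((2 : ℕ) : 𝓞 K) ∈ w.asIdeal) →
        ∃ σ : FramedGaloisRep K (PadicAlgCl 2) 2,
          (∀ (g : absoluteGaloisGroup K) (i j : Fin 2),
            ι ((σ g).val i j) = ((FramedGaloisRep.restrictField K ρ) g).val i j) ∧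
          Finite σ.toMonoidHom.range ∧ σ.toGaloisRep.IsIrreducible ∧
          Nonempty ((Matrix.ProjGenLinGroup.mk.comp σ.toMonoidHom).range ≃*
            alternatingGroup (Fin 5)) ∧
          ∃ (hcpt : isCompact_glFiniteIntegralLevel 2 K)
            (π₀ : CuspidalAutomorphicRepData 2 K hcpt), π₀.1.IsRegularAlgebraic ∧
            ∀ v : HeightOneSpectrum (𝓞 K), (∀ ℓ ∈ S₀, ((ℓ : ℕ) : 𝓞 K) ∉ v.asIdeal) →
              ∃ (α : Multiset ℂ) (P : Polynomial (PadicAlgCl 2)), π₀.1.HasSatakeParamAt v α ∧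
                σ.IsUnramifiedAt v ∧ σ.HasFrobCharpolyAt v P ∧
                ∀ i : ℕ, ‖P.coeff i - (arithFrobPolyOfSatake ι v.residueCard 2 α).coeff i‖ < 1) :=
  fun h => residualBianchiDoorLevelBC_withoutIcosahedral_iff_not_quadraticBaseChangeGL2.mp h hQ

end Summit.Langlands.Langlands.Theorems.ResidualBianchiDoorLevelBC.Negative

end
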